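import Literature.NumberTheory.LFunctions.WeilMarkovQuadratic
import Literature.NumberTheory.LFunctions.WeilWindowSuzukiProofs
import HarnessLib

/-!
# Energy bound for window tests with a sup bound and Lipschitz increments
(crux OddBartaFloor, line Sketch, stub energyBound)

For a Weil test function `h` with `tsupport h ⊆ [-a, a]`, `‖h‖_∞ ≤ M` and increments
`D_s(h) = ∫ |h(x+s) − h(x)|² dx ≤ L s` (`s ≥ 0`), the real part of Weil's quadratic functional is
bounded above by a constant `K = K(a, M, L)` not depending on `h`. Proof: the Markov
decomposition `Re Q(h) = P(h) + 𝓔_a(h) − M_a ‖h‖₂²`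
(`weilQuadratic_re_eq_weilPoleForm_add_weilDirichletEnergy_sub`, Bombieri's explicit formula for
`h ⋆ h̃`), together with

* `‖h‖₂² ≤ 2aM²` and `P(h) ≤ 2 |∫ h cosh(t/2)|² ≤ 2 (2aM cosh(a/2))²`;
* prime part of `𝓔_a(h)`: `D_{log n}(h) ≤ L log n` on the finite index set `weilPrimeIndex a`;
* archimedean part: on `(0, 1]`, `w(t) D_t(h) ≤ (e^{t/2}/(2t)) · L t ≤ L e^{1/2}/2`; on `(1, ∞)`,
  `D_t(h) ≤ 4‖h‖₂² ≤ 8aM²` against the integrable density `w = weilArchDensity`;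
* `−M_a ‖h‖₂² ≤ |M_a| · 2aM²`.

Elementary estimates on top of the tree's Markov decomposition. [folklore]
-/

set_option linter.dupNamespace false

noncomputable section

open Set MeasureTheory Filter Complex
open scoped Real Topology ComplexConjugate ArithmeticFunction.vonMangoldt ENNReal

namespace Summit.RiemannHypothesis.RiemannHypothesis.Theorems.OddBartaFloor

open Literature.NumberTheory.LFunctions

/-- `‖h‖₂² ≤ 2aM²` for `tsupport h ⊆ [-a, a]` and `‖h‖_∞ ≤ M`. [folklore] -/
private theorem stub_energyBound_normSq_le {h : ℝ → ℂ} (hh : IsWeilTest h) {a M : ℝ} (ha : 0 < a)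
    (hsupp : tsupport h ⊆ Icc (-a) a) (hM : ∀ t, ‖h t‖ ≤ M) :
    ∫ x : ℝ, ‖h x‖ ^ 2 ≤ 2 * a * M ^ 2 := by
  have hind : Integrable (fun t : ℝ ↦ (Icc (-a) a).indicator (fun _ ↦ M ^ 2) t) :=
    (continuous_const.integrableOn_Icc (a := -a) (b := a)).integrable_indicator measurableSet_Icc
  calc ∫ x : ℝ, ‖h x‖ ^ 2 ≤ ∫ x : ℝ, (Icc (-a) a).indicator (fun _ ↦ M ^ 2) x := by
        refine integral_mono hh.integrable_norm_sq hind fun x ↦ ?_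
        by_cases hx : x ∈ Icc (-a) a
        · simpa only [indicator_of_mem hx] using pow_le_pow_left₀ (norm_nonneg _) (hM x) 2
        · simp [indicator_of_notMem hx, eq_zero_of_tsupport_subset hsupp hx]
    _ = 2 * a * M ^ 2 := by
        rw [integral_indicator measurableSet_Icc, setIntegral_const,
          Real.volume_real_Icc_of_le (by linarith), smul_eq_mul]
        ring

/-- `P(h) ≤ 2 (2aM cosh(a/2))²` for `tsupport h ⊆ [-a, a]` and `‖h‖_∞ ≤ M`
(`P(h) ≤ 2 |∫ h cosh(t/2)|²`, `cosh(t/2) ≤ cosh(a/2)` on the window). [folklore] -/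
private theorem stub_energyBound_poleForm_le {h : ℝ → ℂ} {a M : ℝ}
    (ha : 0 < a) (hsupp : tsupport h ⊆ Icc (-a) a) (hM : ∀ t, ‖h t‖ ≤ M) :
    weilPoleForm h ≤ 2 * (2 * a * M * Real.cosh (a / 2)) ^ 2 := by
  have hM0 : 0 ≤ M := (norm_nonneg _).trans (hM 0)
  unfold weilPoleForm
  have hCle : ‖∫ t : ℝ, h t * (Real.cosh (t / 2) : ℂ)‖ ≤ 2 * a * M * Real.cosh (a / 2) := by
    have hind : Integrable
        (fun t : ℝ ↦ (Icc (-a) a).indicator (fun _ ↦ M * Real.cosh (a / 2)) t) :=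
      (continuous_const.integrableOn_Icc (a := -a) (b := a)).integrable_indicator measurableSet_Icc
    calc ‖∫ t : ℝ, h t * (Real.cosh (t / 2) : ℂ)‖ ≤ ∫ t : ℝ, ‖h t * (Real.cosh (t / 2) : ℂ)‖ :=
          norm_integral_le_integral_norm _
      _ ≤ ∫ t : ℝ, (Icc (-a) a).indicator (fun _ ↦ M * Real.cosh (a / 2)) t := by
          refine integral_mono_of_nonneg (Eventually.of_forall fun _ ↦ norm_nonneg _) hind
            (Eventually.of_forall fun t ↦ ?_)
          show ‖h t * (Real.cosh (t / 2) : ℂ)‖ ≤ _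
          by_cases ht : t ∈ Icc (-a) a
          · rw [indicator_of_mem ht, norm_mul, Complex.norm_real,
              Real.norm_of_nonneg (Real.cosh_pos _).le]
            have hcosh : Real.cosh (t / 2) ≤ Real.cosh (a / 2) := by
              rw [Real.cosh_le_cosh, abs_div, abs_div, abs_two, abs_of_pos ha]
              exact div_le_div_of_nonneg_right (abs_le.2 ⟨ht.1, ht.2⟩) two_pos.le
            exact mul_le_mul (hM t) hcosh (Real.cosh_pos _).le hM0
          · simp [indicator_of_notMem ht, eq_zero_of_tsupport_subset hsupp ht]
      _ = 2 * a * M * Real.cosh (a / 2) := by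
          rw [integral_indicator measurableSet_Icc, setIntegral_const,
            Real.volume_real_Icc_of_le (by linarith), smul_eq_mul]
          ring
  have hC2 : ‖∫ t : ℝ, h t * (Real.cosh (t / 2) : ℂ)‖ ^ 2 ≤ (2 * a * M * Real.cosh (a / 2)) ^ 2 :=
    pow_le_pow_left₀ (norm_nonneg _) hCle 2
  nlinarith [hC2, sq_nonneg ‖∫ t : ℝ, h t * (Real.sinh (t / 2) : ℂ)‖]

/-- The archimedean energy is bounded by an `h`-free integral: `∫₀^∞ w D_t(h) ≤ ∫₀^∞ F`, with the
majorant `F = L e^{1/2}/2` on `(0, 1]` (`w(t) ≤ e^{t/2}/(2t)`, `D_t ≤ L t`) and `F = 8aM² w` on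
`(1, ∞)` (`D_t ≤ 4‖h‖₂² ≤ 8aM²`). [folklore] -/
private theorem stub_energyBound_arch_le {h : ℝ → ℂ} (hh : IsWeilTest h) {a M L : ℝ} (ha : 0 < a)
    (hsupp : tsupport h ⊆ Icc (-a) a) (hM : ∀ t, ‖h t‖ ≤ M)
    (hL : ∀ s, 0 ≤ s → weilIncrement h s ≤ L * s) :
    ∫ t in Ioi (0 : ℝ), weilArchDensity t * weilIncrement h t ≤
      ∫ t in Ioi (0 : ℝ),
        (if t ≤ 1 then L * Real.exp (1 / 2) / 2 else 8 * a * M ^ 2 * weilArchDensity t) := by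
  have hL0 : 0 ≤ L := by simpa using (weilIncrement_nonneg h 1).trans (hL 1 zero_le_one)
  have hN := stub_energyBound_normSq_le hh ha hsupp hM
  have hFint : IntegrableOn (fun t : ℝ ↦
      (if t ≤ 1 then L * Real.exp (1 / 2) / 2 else 8 * a * M ^ 2 * weilArchDensity t)) (Ioi 0) := by
    rw [← Ioc_union_Ioi_eq_Ioi (zero_le_one : (0 : ℝ) ≤ 1)]
    refine IntegrableOn.union ?_ ?_
    · exact IntegrableOn.congr_fun (continuous_const.integrableOn_Ioc (a := (0 : ℝ)) (b := 1))
        (fun t ht ↦ (if_pos ht.2).symm) measurableSet_Ioc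
    · exact IntegrableOn.congr_fun
        ((integrableOn_weilArchDensity_Ioi one_pos).const_mul (8 * a * M ^ 2))
        (fun t ht ↦ (if_neg (not_le.2 ht)).symm) measurableSet_Ioi
  refine setIntegral_mono_on (integrableOn_weilArchDensity_mul_weilIncrement hh) hFint
    measurableSet_Ioi fun t (ht : 0 < t) ↦ ?_
  have hw0 : 0 ≤ weilArchDensity t := (weilArchDensity_pos ht).le
  by_cases ht1 : t ≤ 1
  · rw [if_pos ht1]
    have htne : t ≠ 0 := ht.ne'
    calc weilArchDensity t * weilIncrement h t ≤ weilArchDensity t * (L * t) :=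
          mul_le_mul_of_nonneg_left (hL t ht.le) hw0
      _ ≤ Real.exp (t / 2) / (2 * t) * (L * t) :=
          mul_le_mul_of_nonneg_right (weilArchDensity_le_exp_half_div ht) (by positivity)
      _ = L * Real.exp (t / 2) / 2 := by
          field_simp
      _ ≤ L * Real.exp (1 / 2) / 2 :=
          div_le_div_of_nonneg_right
            (mul_le_mul_of_nonneg_left (Real.exp_le_exp.2 (by linarith)) hL0) two_pos.le
  · rw [if_neg ht1]
    calc weilArchDensity t * weilIncrement h t ≤ weilArchDensity t * (4 * ∫ x : ℝ, ‖h x‖ ^ 2) :=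
          mul_le_mul_of_nonneg_left (weilIncrement_le hh t) hw0
      _ ≤ weilArchDensity t * (4 * (2 * a * M ^ 2)) := by gcongr
      _ = 8 * a * M ^ 2 * weilArchDensity t := by ring

/-- **Energy bound** (V2b of the line): for fixed `a > 0`, `M`, `L` there is `K = K(a, M, L)` such
that every Weil test function `h` with `tsupport h ⊆ [-a, a]`, `‖h‖_∞ ≤ M` and Lipschitz
increments `D_s(h) ≤ L s` (`s ≥ 0`) has `Re Q(h) ≤ K`. From the Markov decomposition
`Re Q = P + 𝓔_a − M_a ‖·‖₂²` and the three elementary bounds above. [folklore] -/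
theorem stub_energyBound :
    ∀ (a M L : ℝ), 0 < a → ∃ K : ℝ, ∀ h : ℝ → ℂ, IsWeilTest h → tsupport h ⊆ Icc (-a) a →
      (∀ t, ‖h t‖ ≤ M) → (∀ s, 0 ≤ s → weilIncrement h s ≤ L * s) → (weilQuadratic h).re ≤ K := by
  intro a M L ha
  refine ⟨2 * (2 * a * M * Real.cosh (a / 2)) ^ 2 +
    ((∑ n ∈ weilPrimeIndex a, (Λ n : ℝ) / Real.sqrt n * (L * Real.log n)) +
      ∫ t in Ioi (0 : ℝ),
        (if t ≤ 1 then L * Real.exp (1 / 2) / 2 else 8 * a * M ^ 2 * weilArchDensity t)) +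
    |weilMarkovConstant a| * (2 * a * M ^ 2), fun h hh hsupp hM hL ↦ ?_⟩
  rw [weilQuadratic_re_eq_weilPoleForm_add_weilDirichletEnergy_sub hh hsupp]
  have hN0 : 0 ≤ ∫ x : ℝ, ‖h x‖ ^ 2 := integral_nonneg fun _ ↦ by positivity
  have hN := stub_energyBound_normSq_le hh ha hsupp hM
  have hP := stub_energyBound_poleForm_le ha hsupp hM
  have hE : weilDirichletEnergy a h ≤
      (∑ n ∈ weilPrimeIndex a, (Λ n : ℝ) / Real.sqrt n * (L * Real.log n)) +
        ∫ t in Ioi (0 : ℝ),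
          (if t ≤ 1 then L * Real.exp (1 / 2) / 2 else 8 * a * M ^ 2 * weilArchDensity t) := by
    unfold weilDirichletEnergy
    exact add_le_add (Finset.sum_le_sum fun n _ ↦ mul_le_mul_of_nonneg_left
      (hL _ (Real.log_natCast_nonneg n))
      (div_nonneg ArithmeticFunction.vonMangoldt_nonneg (Real.sqrt_nonneg _)))
      (stub_energyBound_arch_le hh ha hsupp hM hL)
  have hK : -(weilMarkovConstant a * ∫ x : ℝ, ‖h x‖ ^ 2) ≤
      |weilMarkovConstant a| * (2 * a * M ^ 2) :=
    calc -(weilMarkovConstant a * ∫ x : ℝ, ‖h x‖ ^ 2)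
        ≤ |weilMarkovConstant a * ∫ x : ℝ, ‖h x‖ ^ 2| := neg_le_abs _
      _ = |weilMarkovConstant a| * ∫ x : ℝ, ‖h x‖ ^ 2 := by rw [abs_mul, abs_of_nonneg hN0]
      _ ≤ |weilMarkovConstant a| * (2 * a * M ^ 2) := mul_le_mul_of_nonneg_left hN (abs_nonneg _)
  linarith

end Summit.RiemannHypothesis.RiemannHypothesis.Theorems.OddBartaFloor

end
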